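import Summits.CriticalPhenomena.SAWScalingLimit.Theorems.NoFoldBound.Negative.Ring12Turning

/-!
# `NoFoldBound` negative lemmas, holed witness III: the walks to the antipode (mid-edges `A`, `B`)

Part 3 of 4. The source mid-edge `srcR`, the head/prefix structure of the walks of `Λ₁₂` from it
(`verts_mem_ringPrefixes`, from `ring_classify`), and for the two mid-edges `{v, A}`, `{v, B}` of the
antipode `v = (![-1,2],0)` (`A = (![-1,2],1)`, `B = (![-2,2],1)`): the two walks reaching each
(`walk_A1/A2`, `walk_B1/B2`, one round each side of the hole), the proof that there are no others
(`verts_cases_A/B`: 24 prefix cases, the wrong ends and the two edge-repeating ones excluded by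
`decide`), the observable as the sum of the two weights, and the windings `2, −1, 1, −2` (units `π/3`).
-/

open Literature.Probability.LatticeModels Literature.Probability.RandomPlanarGeometry.SAW
open Literature.Probability.RandomPlanarGeometry.SAW.HV (omg omg_sq omg_add_one_ne_zero triZeta_eq_omg omg_pow_three
  two_mul_xc_mul_cos)

namespace Summit.CriticalPhenomena.SAWScalingLimit.Theorems.NoFoldBound.Negative

/-! ### The source and the six walks reaching the antipode `v = (![-1,2],0)` -/

/-- The source mid-edge `a = {(![0,-1],1) ∉ Λ₁₂, (![0,0],0) ∈ Λ₁₂}` (outer boundary). [folklore] -/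
def srcR : Sym2 HexVertex := s((![0, -1], 1), (![0, 0], 0))

/-- Auxiliary computation `srcR_mem_boundary` for the 12-ring witness. [folklore] -/
theorem srcR_mem_boundary : srcR ∈ hexDomainBoundary Λ₁₂ := by
  refine ⟨?_, (![0, -1], 1), (![0, 0], 0), rfl, by decide, by decide⟩
  exact (SimpleGraph.mem_edgeSet hexGraph).2 (by decide)

/-- The head of a walk of `Λ₁₂` from `srcR` is the source vertex. [folklore] -/
theorem head_eq_of_walk {z : Sym2 HexVertex} (γ : HexMidEdgeSAW Λ₁₂ srcR z) (hne : γ.verts ≠ []) :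
    γ.verts.head? = some (![0, 0], 0) := by
  obtain ⟨x, l, hx⟩ := List.exists_cons_of_ne_nil hne
  have h1 := γ.head_mem x (by rw [hx]; rfl)
  have h2 : x ∈ Λ₁₂ := γ.subset x (by rw [hx]; simp)
  rw [hx, List.head?_cons, Option.some.injEq]
  rcases Sym2.mem_iff.1 h1 with rfl | rfl
  · exact absurd h2 (by decide)
  · rfl

/-- The vertex list of a walk of `Λ₁₂` from `srcR` is a ring prefix. [folklore] -/
theorem verts_mem_ringPrefixes {z : Sym2 HexVertex} (γ : HexMidEdgeSAW Λ₁₂ srcR z) (hne : γ.verts ≠ []) :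
    γ.verts ∈ ringPrefixes := by
  have hl : γ.verts.length = (γ.verts.length - 1) + 1 := by
    have := List.length_pos_of_ne_nil hne; omega
  exact ring_classify _ γ.verts hl γ.isChain γ.subset γ.nodup (head_eq_of_walk γ hne)

/-- Walk 1 to the mid-edge `{v, A}`: `[(0, 0, 0), (0, 0, 1), (0, 1, 0), (0, 1, 1), (0, 2, 0), (-1, 2, 1)]`. [folklore] -/
def walk_A1 : HexMidEdgeSAW Λ₁₂ srcR s((![-1, 2], 0), (![-1, 2], 1)) where
  verts := [(![0, 0], 0), (![0, 0], 1), (![0, 1], 0), (![0, 1], 1), (![0, 2], 0), (![-1, 2], 1)]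
  subset := by decide
  nodup := by decide
  isChain := by decide
  head_mem := by intro w hw; simp only [List.head?_cons, Option.some.injEq] at hw; subst hw; simp [srcR]
  getLast_mem := by intro w hw; simp at hw; subst hw; simp
  eq_of_nil := by intro h; simp at h
  edges_nodup := by intro _; decide
  fst_mem := hexDomainBoundary_subset _ srcR_mem_boundary

/-- Walk 2 to the mid-edge `{v, A}`: `[(0, 0, 0), (-1, 0, 1), (-1, 1, 0), (-2, 1, 1), (-2, 2, 0), (-2, 2, 1), (-1, 2, 0)]`. [folklore] -/
def walk_A2 : HexMidEdgeSAW Λ₁₂ srcR s((![-1, 2], 0), (![-1, 2], 1)) where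
  verts := [(![0, 0], 0), (![-1, 0], 1), (![-1, 1], 0), (![-2, 1], 1), (![-2, 2], 0), (![-2, 2], 1), (![-1, 2], 0)]
  subset := by decide
  nodup := by decide
  isChain := by decide
  head_mem := by intro w hw; simp only [List.head?_cons, Option.some.injEq] at hw; subst hw; simp [srcR]
  getLast_mem := by intro w hw; simp at hw; subst hw; simp
  eq_of_nil := by intro h; simp at h
  edges_nodup := by intro _; decide
  fst_mem := hexDomainBoundary_subset _ srcR_mem_boundary

/-- The walks of `Λ₁₂` from `srcR` to the mid-edge `{v, A}` are exactly `walk_A1`, `walk_A2`. [folklore] -/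
theorem verts_cases_A (γ : HexMidEdgeSAW Λ₁₂ srcR s((![-1, 2], 0), (![-1, 2], 1))) :
    γ.verts = [(![0, 0], 0), (![0, 0], 1), (![0, 1], 0), (![0, 1], 1), (![0, 2], 0), (![-1, 2], 1)] ∨ γ.verts = [(![0, 0], 0), (![-1, 0], 1), (![-1, 1], 0), (![-2, 1], 1), (![-2, 2], 0), (![-2, 2], 1), (![-1, 2], 0)] := by
  have hne : γ.verts ≠ [] := fun h => absurd (γ.eq_of_nil h) (by decide)
  have hm := verts_mem_ringPrefixes γ hne
  simp only [ringPrefixes, List.mem_append, List.mem_map, List.mem_range] at hm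
  obtain ⟨k, hk, hk'⟩ | ⟨k, hk, hk'⟩ := hm
  · interval_cases k
    · -- ringD1, k = 0, last (0, 0, 0): notlast
      exfalso
      have h := γ.getLast_mem (![0, 0], 0) (by rw [← hk']; rfl)
      exact absurd h (by decide)
    · -- ringD1, k = 1, last (0, 0, 1): notlast
      exfalso
      have h := γ.getLast_mem (![0, 0], 1) (by rw [← hk']; rfl)
      exact absurd h (by decide)
    · -- ringD1, k = 2, last (0, 1, 0): notlast
      exfalso
      have h := γ.getLast_mem (![0, 1], 0) (by rw [← hk']; rfl)
      exact absurd h (by decide)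
    · -- ringD1, k = 3, last (0, 1, 1): notlast
      exfalso
      have h := γ.getLast_mem (![0, 1], 1) (by rw [← hk']; rfl)
      exact absurd h (by decide)
    · -- ringD1, k = 4, last (0, 2, 0): notlast
      exfalso
      have h := γ.getLast_mem (![0, 2], 0) (by rw [← hk']; rfl)
      exact absurd h (by decide)
    · -- ringD1, k = 5, last (-1, 2, 1): ok1
      left; rw [← hk']; rfl
    · -- ringD1, k = 6, last (-1, 2, 0): edge
      exfalso
      have h := γ.edges_nodup hne
      rw [← hk'] at h
      exact absurd h (by decide)
    · -- ringD1, k = 7, last (-2, 2, 1): notlast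
      exfalso
      have h := γ.getLast_mem (![-2, 2], 1) (by rw [← hk']; rfl)
      exact absurd h (by decide)
    · -- ringD1, k = 8, last (-2, 2, 0): notlast
      exfalso
      have h := γ.getLast_mem (![-2, 2], 0) (by rw [← hk']; rfl)
      exact absurd h (by decide)
    · -- ringD1, k = 9, last (-2, 1, 1): notlast
      exfalso
      have h := γ.getLast_mem (![-2, 1], 1) (by rw [← hk']; rfl)
      exact absurd h (by decide)
    · -- ringD1, k = 10, last (-1, 1, 0): notlast
      exfalso
      have h := γ.getLast_mem (![-1, 1], 0) (by rw [← hk']; rfl)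
      exact absurd h (by decide)
    · -- ringD1, k = 11, last (-1, 0, 1): notlast
      exfalso
      have h := γ.getLast_mem (![-1, 0], 1) (by rw [← hk']; rfl)
      exact absurd h (by decide)
  · interval_cases k
    · -- ringD2, k = 0, last (0, 0, 0): notlast
      exfalso
      have h := γ.getLast_mem (![0, 0], 0) (by rw [← hk']; rfl)
      exact absurd h (by decide)
    · -- ringD2, k = 1, last (-1, 0, 1): notlast
      exfalso
      have h := γ.getLast_mem (![-1, 0], 1) (by rw [← hk']; rfl)
      exact absurd h (by decide)
    · -- ringD2, k = 2, last (-1, 1, 0): notlast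
      exfalso
      have h := γ.getLast_mem (![-1, 1], 0) (by rw [← hk']; rfl)
      exact absurd h (by decide)
    · -- ringD2, k = 3, last (-2, 1, 1): notlast
      exfalso
      have h := γ.getLast_mem (![-2, 1], 1) (by rw [← hk']; rfl)
      exact absurd h (by decide)
    · -- ringD2, k = 4, last (-2, 2, 0): notlast
      exfalso
      have h := γ.getLast_mem (![-2, 2], 0) (by rw [← hk']; rfl)
      exact absurd h (by decide)
    · -- ringD2, k = 5, last (-2, 2, 1): notlast
      exfalso
      have h := γ.getLast_mem (![-2, 2], 1) (by rw [← hk']; rfl)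
      exact absurd h (by decide)
    · -- ringD2, k = 6, last (-1, 2, 0): ok2
      right; rw [← hk']; rfl
    · -- ringD2, k = 7, last (-1, 2, 1): edge
      exfalso
      have h := γ.edges_nodup hne
      rw [← hk'] at h
      exact absurd h (by decide)
    · -- ringD2, k = 8, last (0, 2, 0): notlast
      exfalso
      have h := γ.getLast_mem (![0, 2], 0) (by rw [← hk']; rfl)
      exact absurd h (by decide)
    · -- ringD2, k = 9, last (0, 1, 1): notlast
      exfalso
      have h := γ.getLast_mem (![0, 1], 1) (by rw [← hk']; rfl)
      exact absurd h (by decide)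
    · -- ringD2, k = 10, last (0, 1, 0): notlast
      exfalso
      have h := γ.getLast_mem (![0, 1], 0) (by rw [← hk']; rfl)
      exact absurd h (by decide)
    · -- ringD2, k = 11, last (0, 0, 1): notlast
      exfalso
      have h := γ.getLast_mem (![0, 0], 1) (by rw [← hk']; rfl)
      exact absurd h (by decide)

/-- The two walks differ. [folklore] -/
theorem walk_A1_ne_walk_A2 : walk_A1 ≠ walk_A2 := fun h => by
  have := congrArg HexMidEdgeSAW.verts h; exact absurd this (by decide)

/-- `F{v,A}` is the sum of the weights of the two walks. [folklore] -/
theorem observable_A (x σ : ℝ) : hexParafermionicObservable Λ₁₂ srcR x σ s((![-1, 2], 0), (![-1, 2], 1)) =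
    walk_A1.weight x σ + walk_A2.weight x σ := by
  rw [hexParafermionicObservable]
  refine Finset.sum_eq_add walk_A1 walk_A2 walk_A1_ne_walk_A2 (fun γ _ hγ => ?_) (by simp) (by simp)
  exfalso
  rcases verts_cases_A γ with h | h
  · exact hγ.1 (HexMidEdgeSAW.ext h)
  · exact hγ.2 (HexMidEdgeSAW.ext h)

/-- Winding of `walk_A1`: `2 · (π/3)`. [folklore] -/
theorem winding_walk_A1 : walk_A1.winding = (2 : ℝ) * (Real.pi / 3) := by
  simp only [HexMidEdgeSAW.winding, HexMidEdgeSAW.points, walk_A1, srcR, List.map_cons, List.map_nil,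
    List.cons_append, List.nil_append, winding_cons_cons_cons, winding_pair,
    turn_00, turn_01, turn_02, turn_03, turn_04, turn_05]
  ring

/-- Weight of `walk_A1`: `e^{-iσ·2π/3} x^6`. [folklore] -/
theorem weight_walk_A1 (x σ : ℝ) : walk_A1.weight x σ =
    Complex.exp (-Complex.I * σ * (((2 : ℝ) * (Real.pi / 3) : ℝ) : ℂ)) * (x : ℂ) ^ 6 := by
  rw [HexMidEdgeSAW.weight, winding_walk_A1]; rfl

/-- Winding of `walk_A2`: `-1 · (π/3)`. [folklore] -/
theorem winding_walk_A2 : walk_A2.winding = (-1 : ℝ) * (Real.pi / 3) := by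
  simp only [HexMidEdgeSAW.winding, HexMidEdgeSAW.points, walk_A2, srcR, List.map_cons, List.map_nil,
    List.cons_append, List.nil_append, winding_cons_cons_cons, winding_pair,
    turn_06, turn_07, turn_08, turn_09, turn_10, turn_11, turn_12]
  ring

/-- Weight of `walk_A2`: `e^{-iσ·-1π/3} x^7`. [folklore] -/
theorem weight_walk_A2 (x σ : ℝ) : walk_A2.weight x σ =
    Complex.exp (-Complex.I * σ * (((-1 : ℝ) * (Real.pi / 3) : ℝ) : ℂ)) * (x : ℂ) ^ 7 := by
  rw [HexMidEdgeSAW.weight, winding_walk_A2]; rfl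

/-- Walk 1 to the mid-edge `{v, B}`: `[(0, 0, 0), (0, 0, 1), (0, 1, 0), (0, 1, 1), (0, 2, 0), (-1, 2, 1), (-1, 2, 0)]`. [folklore] -/
def walk_B1 : HexMidEdgeSAW Λ₁₂ srcR s((![-1, 2], 0), (![-2, 2], 1)) where
  verts := [(![0, 0], 0), (![0, 0], 1), (![0, 1], 0), (![0, 1], 1), (![0, 2], 0), (![-1, 2], 1), (![-1, 2], 0)]
  subset := by decide
  nodup := by decide
  isChain := by decide
  head_mem := by intro w hw; simp only [List.head?_cons, Option.some.injEq] at hw; subst hw; simp [srcR]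
  getLast_mem := by intro w hw; simp at hw; subst hw; simp
  eq_of_nil := by intro h; simp at h
  edges_nodup := by intro _; decide
  fst_mem := hexDomainBoundary_subset _ srcR_mem_boundary

/-- Walk 2 to the mid-edge `{v, B}`: `[(0, 0, 0), (-1, 0, 1), (-1, 1, 0), (-2, 1, 1), (-2, 2, 0), (-2, 2, 1)]`. [folklore] -/
def walk_B2 : HexMidEdgeSAW Λ₁₂ srcR s((![-1, 2], 0), (![-2, 2], 1)) where
  verts := [(![0, 0], 0), (![-1, 0], 1), (![-1, 1], 0), (![-2, 1], 1), (![-2, 2], 0), (![-2, 2], 1)]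
  subset := by decide
  nodup := by decide
  isChain := by decide
  head_mem := by intro w hw; simp only [List.head?_cons, Option.some.injEq] at hw; subst hw; simp [srcR]
  getLast_mem := by intro w hw; simp at hw; subst hw; simp
  eq_of_nil := by intro h; simp at h
  edges_nodup := by intro _; decide
  fst_mem := hexDomainBoundary_subset _ srcR_mem_boundary

/-- The walks of `Λ₁₂` from `srcR` to the mid-edge `{v, B}` are exactly `walk_B1`, `walk_B2`. [folklore] -/
theorem verts_cases_B (γ : HexMidEdgeSAW Λ₁₂ srcR s((![-1, 2], 0), (![-2, 2], 1))) :
    γ.verts = [(![0, 0], 0), (![0, 0], 1), (![0, 1], 0), (![0, 1], 1), (![0, 2], 0), (![-1, 2], 1), (![-1, 2], 0)] ∨ γ.verts = [(![0, 0], 0), (![-1, 0], 1), (![-1, 1], 0), (![-2, 1], 1), (![-2, 2], 0), (![-2, 2], 1)] := by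
  have hne : γ.verts ≠ [] := fun h => absurd (γ.eq_of_nil h) (by decide)
  have hm := verts_mem_ringPrefixes γ hne
  simp only [ringPrefixes, List.mem_append, List.mem_map, List.mem_range] at hm
  obtain ⟨k, hk, hk'⟩ | ⟨k, hk, hk'⟩ := hm
  · interval_cases k
    · -- ringD1, k = 0, last (0, 0, 0): notlast
      exfalso
      have h := γ.getLast_mem (![0, 0], 0) (by rw [← hk']; rfl)
      exact absurd h (by decide)
    · -- ringD1, k = 1, last (0, 0, 1): notlast
      exfalso
      have h := γ.getLast_mem (![0, 0], 1) (by rw [← hk']; rfl)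
      exact absurd h (by decide)
    · -- ringD1, k = 2, last (0, 1, 0): notlast
      exfalso
      have h := γ.getLast_mem (![0, 1], 0) (by rw [← hk']; rfl)
      exact absurd h (by decide)
    · -- ringD1, k = 3, last (0, 1, 1): notlast
      exfalso
      have h := γ.getLast_mem (![0, 1], 1) (by rw [← hk']; rfl)
      exact absurd h (by decide)
    · -- ringD1, k = 4, last (0, 2, 0): notlast
      exfalso
      have h := γ.getLast_mem (![0, 2], 0) (by rw [← hk']; rfl)
      exact absurd h (by decide)
    · -- ringD1, k = 5, last (-1, 2, 1): notlast
      exfalso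
      have h := γ.getLast_mem (![-1, 2], 1) (by rw [← hk']; rfl)
      exact absurd h (by decide)
    · -- ringD1, k = 6, last (-1, 2, 0): ok1
      left; rw [← hk']; rfl
    · -- ringD1, k = 7, last (-2, 2, 1): edge
      exfalso
      have h := γ.edges_nodup hne
      rw [← hk'] at h
      exact absurd h (by decide)
    · -- ringD1, k = 8, last (-2, 2, 0): notlast
      exfalso
      have h := γ.getLast_mem (![-2, 2], 0) (by rw [← hk']; rfl)
      exact absurd h (by decide)
    · -- ringD1, k = 9, last (-2, 1, 1): notlast
      exfalso
      have h := γ.getLast_mem (![-2, 1], 1) (by rw [← hk']; rfl)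
      exact absurd h (by decide)
    · -- ringD1, k = 10, last (-1, 1, 0): notlast
      exfalso
      have h := γ.getLast_mem (![-1, 1], 0) (by rw [← hk']; rfl)
      exact absurd h (by decide)
    · -- ringD1, k = 11, last (-1, 0, 1): notlast
      exfalso
      have h := γ.getLast_mem (![-1, 0], 1) (by rw [← hk']; rfl)
      exact absurd h (by decide)
  · interval_cases k
    · -- ringD2, k = 0, last (0, 0, 0): notlast
      exfalso
      have h := γ.getLast_mem (![0, 0], 0) (by rw [← hk']; rfl)
      exact absurd h (by decide)
    · -- ringD2, k = 1, last (-1, 0, 1): notlast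
      exfalso
      have h := γ.getLast_mem (![-1, 0], 1) (by rw [← hk']; rfl)
      exact absurd h (by decide)
    · -- ringD2, k = 2, last (-1, 1, 0): notlast
      exfalso
      have h := γ.getLast_mem (![-1, 1], 0) (by rw [← hk']; rfl)
      exact absurd h (by decide)
    · -- ringD2, k = 3, last (-2, 1, 1): notlast
      exfalso
      have h := γ.getLast_mem (![-2, 1], 1) (by rw [← hk']; rfl)
      exact absurd h (by decide)
    · -- ringD2, k = 4, last (-2, 2, 0): notlast
      exfalso
      have h := γ.getLast_mem (![-2, 2], 0) (by rw [← hk']; rfl)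
      exact absurd h (by decide)
    · -- ringD2, k = 5, last (-2, 2, 1): ok2
      right; rw [← hk']; rfl
    · -- ringD2, k = 6, last (-1, 2, 0): edge
      exfalso
      have h := γ.edges_nodup hne
      rw [← hk'] at h
      exact absurd h (by decide)
    · -- ringD2, k = 7, last (-1, 2, 1): notlast
      exfalso
      have h := γ.getLast_mem (![-1, 2], 1) (by rw [← hk']; rfl)
      exact absurd h (by decide)
    · -- ringD2, k = 8, last (0, 2, 0): notlast
      exfalso
      have h := γ.getLast_mem (![0, 2], 0) (by rw [← hk']; rfl)
      exact absurd h (by decide)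
    · -- ringD2, k = 9, last (0, 1, 1): notlast
      exfalso
      have h := γ.getLast_mem (![0, 1], 1) (by rw [← hk']; rfl)
      exact absurd h (by decide)
    · -- ringD2, k = 10, last (0, 1, 0): notlast
      exfalso
      have h := γ.getLast_mem (![0, 1], 0) (by rw [← hk']; rfl)
      exact absurd h (by decide)
    · -- ringD2, k = 11, last (0, 0, 1): notlast
      exfalso
      have h := γ.getLast_mem (![0, 0], 1) (by rw [← hk']; rfl)
      exact absurd h (by decide)

/-- The two walks differ. [folklore] -/
theorem walk_B1_ne_walk_B2 : walk_B1 ≠ walk_B2 := fun h => by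
  have := congrArg HexMidEdgeSAW.verts h; exact absurd this (by decide)

/-- `F{v,B}` is the sum of the weights of the two walks. [folklore] -/
theorem observable_B (x σ : ℝ) : hexParafermionicObservable Λ₁₂ srcR x σ s((![-1, 2], 0), (![-2, 2], 1)) =
    walk_B1.weight x σ + walk_B2.weight x σ := by
  rw [hexParafermionicObservable]
  refine Finset.sum_eq_add walk_B1 walk_B2 walk_B1_ne_walk_B2 (fun γ _ hγ => ?_) (by simp) (by simp)
  exfalso
  rcases verts_cases_B γ with h | h
  · exact hγ.1 (HexMidEdgeSAW.ext h)
  · exact hγ.2 (HexMidEdgeSAW.ext h)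

/-- Winding of `walk_B1`: `1 · (π/3)`. [folklore] -/
theorem winding_walk_B1 : walk_B1.winding = (1 : ℝ) * (Real.pi / 3) := by
  simp only [HexMidEdgeSAW.winding, HexMidEdgeSAW.points, walk_B1, srcR, List.map_cons, List.map_nil,
    List.cons_append, List.nil_append, winding_cons_cons_cons, winding_pair,
    turn_00, turn_01, turn_02, turn_03, turn_04, turn_13, turn_14]
  ring

/-- Weight of `walk_B1`: `e^{-iσ·1π/3} x^7`. [folklore] -/
theorem weight_walk_B1 (x σ : ℝ) : walk_B1.weight x σ =
    Complex.exp (-Complex.I * σ * (((1 : ℝ) * (Real.pi / 3) : ℝ) : ℂ)) * (x : ℂ) ^ 7 := by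
  rw [HexMidEdgeSAW.weight, winding_walk_B1]; rfl

/-- Winding of `walk_B2`: `-2 · (π/3)`. [folklore] -/
theorem winding_walk_B2 : walk_B2.winding = (-2 : ℝ) * (Real.pi / 3) := by
  simp only [HexMidEdgeSAW.winding, HexMidEdgeSAW.points, walk_B2, srcR, List.map_cons, List.map_nil,
    List.cons_append, List.nil_append, winding_cons_cons_cons, winding_pair,
    turn_06, turn_07, turn_08, turn_09, turn_10, turn_15]
  ring

/-- Weight of `walk_B2`: `e^{-iσ·-2π/3} x^6`. [folklore] -/
theorem weight_walk_B2 (x σ : ℝ) : walk_B2.weight x σ =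
    Complex.exp (-Complex.I * σ * (((-2 : ℝ) * (Real.pi / 3) : ℝ) : ℂ)) * (x : ℂ) ^ 6 := by
  rw [HexMidEdgeSAW.weight, winding_walk_B2]; rfl

end Summit.CriticalPhenomena.SAWScalingLimit.Theorems.NoFoldBound.Negative
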